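import Summits.ValiantsHypothesis.ValiantsHypothesis.Theses.KPlusLogSqLaw
import Summits.ValiantsHypothesis.ValiantsHypothesis.Theorems.KPlusLogSqLawTropicalBSignsFree

/-!
# Route «KPlusLogSqLaw», crux `TropicalB` (stmt-ValiantsHypothesis-19771) — the crux WITHOUT CHAINS:
# `TropicalB` ⟺ «every dominance design of format (m, K) has at most 2^(C (K + ⌊log₂ m⌋²)) terms that are dominant at some
# integer slope» (the number of integer-exposed vertices of the tropical determinant)

HONEST FRAMING.  Helper file toward the registered stub `stub_tropFat` (⟺ `TropicalB`) of `Cruxes/TropicalB/Lines/birth.lean`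
(crux `Summit.ValiantsHypothesis.ValiantsHypothesis.Theses.KPlusLogSqLaw.TropicalB`, ledger item `stmt-ValiantsHypothesis-19771`,
route `KPlusLogSqLaw`; cell `pub-symmetroid`, seat val-sym-trop-p2 (g2), 2026-08-26).  A reformulation of an OPEN statement; nothing
is asserted about `TropicalB`, `WeakLifting`, `KPlusLogSqLaw`, `MatrixDescartes` (stmt-ValiantsHypothesis-18050) or VP ≠ VNP.

With signs gone (`tropicalB_iff_unsigned`, `…TropicalBSignsFree`), chains can go too.  For a design `(d, v, ε)` let
`Dom = {p : ∃ θ ∈ ℤ, IsDominant d v ε θ p}` be the set of Leibniz terms that are the unique optimum at SOME integer slope (the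
vertices of the upper envelope `θ ↦ max_p tropWeight` whose supporting cone contains an integer).

* `succ_le_card_dominant` — an unsigned dominant chain `p₀, …, pₙ` consists of `n + 1` distinct members of `Dom`;
* `card_dominant_le_succ` — `DesignRowD d v ε B → #Dom ≤ B + 1`: distinct dominant terms have distinct slopes θ (uniqueness of the
  optimum), and listing `Dom` by increasing θ IS an unsigned dominant chain;
* `tropicalB_iff_cardDominant` — `TropicalB ↔ ∃ C, ∀ m K d v ε, #Dom ≤ 2^(C (K + ⌊log₂ m⌋²))`.

READING (located, not claimed).  The crux is a pure VERTEX COUNT: at most `2^(O(K + log² m))` Leibniz terms of an `m × m`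
dominance design with `K` slope classes can ever be the unique tropical optimum at an integer slope (scaling `v` makes every vertex
of the envelope integer-exposed, so this is the number of vertices of the upper envelope, i.e. of the relevant 2-D shadow).
[folklore] sorting a finite set of slopes.
-/

set_option linter.dupNamespace false
set_option autoImplicit false

namespace Summit.ValiantsHypothesis.ValiantsHypothesis.Theorems.KPlusLogSqLaw

open Summit.ValiantsHypothesis.ValiantsHypothesis.Theorems.LacunarySymmetroidMatrixDescartes.TropicalCensus
open Summit.ValiantsHypothesis.ValiantsHypothesis.Theorems.MatrixDescartes.Negative
open Summit.ValiantsHypothesis.ValiantsHypothesis.Theses.KPlusLogSqLaw (TropicalB)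
open Finset

section VertexCount

variable {m K : ℕ}

/-- Two terms dominant at the same integer slope are equal (the optimum is unique). [folklore] -/
theorem eq_of_isDominant_of_isDominant (d : Fin K → ℕ) (v ε : Fin m → Fin m → Fin K → ℤ) {θ : ℤ}
    {p q : Equiv.Perm (Fin m) × (Fin m → Fin K)} (hp : IsDominant d v ε θ p) (hq : IsDominant d v ε θ q) : p = q := by
  by_contra hne
  have h1 := hp.2 q (Ne.symm hne) hq.1
  have h2 := hq.2 p hne hp.1
  exact absurd h1 (not_lt.mpr h2.le)

open scoped Classical in
/-- **A chain lives in `Dom`.**  An unsigned dominant chain `p₀, …, pₙ` (consecutive terms distinct) has `n + 1` pairwise distinct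
terms, all dominant at some integer slope: `n + 1 ≤ #Dom`. [folklore] -/
theorem succ_le_card_dominant (d : Fin K → ℕ) (v ε : Fin m → Fin m → Fin K → ℤ) {n : ℕ} (θ : Fin (n + 1) → ℤ)
    (p : Fin (n + 1) → Equiv.Perm (Fin m) × (Fin m → Fin K)) (hθ : StrictMono θ)
    (hdom : ∀ k, IsDominant d v ε (θ k) (p k)) (hne : ∀ k : Fin n, p k.castSucc ≠ p k.succ) :
    n + 1 ≤ (univ.filter fun q : Equiv.Perm (Fin m) × (Fin m → Fin K) => ∃ t : ℤ, IsDominant d v ε t q).card := by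
  classical
  have hinj : Function.Injective p := injective_of_chainD d v ε θ p hθ hdom hne
  calc n + 1 = (univ.image p).card := by rw [card_image_of_injective _ hinj, card_univ, Fintype.card_fin]
    _ ≤ _ := by
        refine card_le_card fun q hq => ?_
        obtain ⟨k, -, rfl⟩ := mem_image.mp hq
        exact mem_filter.mpr ⟨mem_univ _, θ k, hdom k⟩

open scoped Classical in
/-- **`Dom` is a chain.**  If the design satisfies the unsigned row bound `DesignRowD d v ε B`, then at most `B + 1` of its terms are
dominant at some integer slope: choose one slope per dominant term (they are pairwise distinct by uniqueness of the optimum) and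
list the terms by increasing slope — an unsigned dominant chain. [folklore] -/
theorem card_dominant_le_succ (d : Fin K → ℕ) (v ε : Fin m → Fin m → Fin K → ℤ) {B : ℕ} (h : DesignRowD d v ε B) :
    (univ.filter fun q : Equiv.Perm (Fin m) × (Fin m → Fin K) => ∃ t : ℤ, IsDominant d v ε t q).card ≤ B + 1 := by
  classical
  set D := univ.filter fun q : Equiv.Perm (Fin m) × (Fin m → Fin K) => ∃ t : ℤ, IsDominant d v ε t q with hD
  rcases Nat.eq_zero_or_pos D.card with h0 | hpos
  · omega
  obtain ⟨N, hN⟩ : ∃ N, D.card = N + 1 := ⟨D.card - 1, by omega⟩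
  -- a slope for every dominant term
  have hmem : ∀ q ∈ D, ∃ t : ℤ, IsDominant d v ε t q := fun q hq => (mem_filter.mp hq).2
  choose! slope hslope using hmem
  have hinj : Set.InjOn slope D := by
    intro q hq q' hq' hqq'
    have h1 := hslope q hq
    have h2 := hslope q' hq'
    rw [hqq'] at h1
    exact eq_of_isDominant_of_isDominant d v ε h1 h2
  set Θ := D.image slope with hΘ
  have hΘcard : Θ.card = N + 1 := by rw [hΘ, card_image_of_injOn hinj, hN]
  set g := Θ.orderEmbOfFin hΘcard with hg
  -- the term exposed at the i-th slope
  have hterm : ∀ i : Fin (N + 1), ∃ q ∈ D, slope q = g i := by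
    intro i
    have hi : g i ∈ Θ := Θ.orderEmbOfFin_mem hΘcard i
    obtain ⟨q, hq, hqi⟩ := mem_image.mp hi
    exact ⟨q, hq, hqi⟩
  choose term hterm_mem hterm_slope using hterm
  have hdom : ∀ i, IsDominant d v ε (g i) (term i) := by
    intro i
    rw [← hterm_slope i]
    exact hslope _ (hterm_mem i)
  have hne : ∀ k : Fin N, term k.castSucc ≠ term k.succ := by
    intro k heq
    have h1 : g k.castSucc = g k.succ := by rw [← hterm_slope, ← hterm_slope, heq]
    have h2 : g k.castSucc < g k.succ := g.strictMono Fin.castSucc_lt_succ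
    exact absurd h1 (ne_of_lt h2)
  have hle : N ≤ B := h N (fun i => g i) term g.strictMono hdom hne
  omega

open scoped Classical in
/-- **`TropicalB` ⟺ the vertex count.**  The crux is equivalent to: there is an absolute `C` such that every dominance design of
format `(m, K)` has at most `2^(C (K + ⌊log₂ m⌋²))` Leibniz terms that are dominant (the unique tropical optimum) at some integer
slope. -/
theorem tropicalB_iff_cardDominant :
    TropicalB ↔ ∃ C : ℕ, ∀ (m K : ℕ) (d : Fin K → ℕ) (v ε : Fin m → Fin m → Fin K → ℤ),
      (univ.filter fun q : Equiv.Perm (Fin m) × (Fin m → Fin K) => ∃ t : ℤ, IsDominant d v ε t q).card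
        ≤ 2 ^ (C * (K + Nat.log 2 m ^ 2)) := by
  classical
  constructor
  · intro hTB
    obtain ⟨C, hC⟩ := tropicalB_iff_unsigned.mp hTB
    refine ⟨C + 1, fun m K d v ε => ?_⟩
    rcases Nat.eq_zero_or_pos K with rfl | hK
    · -- no classes: at most one term exists at all
      rcases Nat.eq_zero_or_pos m with rfl | hm
      · calc (univ.filter fun q : Equiv.Perm (Fin 0) × (Fin 0 → Fin 0) => ∃ t : ℤ, IsDominant d v ε t q).card
            ≤ (univ : Finset (Equiv.Perm (Fin 0) × (Fin 0 → Fin 0))).card := card_le_univ _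
          _ ≤ 1 := by simp
          _ ≤ _ := Nat.one_le_two_pow
      · have hempty : (univ.filter fun q : Equiv.Perm (Fin m) × (Fin m → Fin 0) => ∃ t : ℤ, IsDominant d v ε t q) = ∅ :=
          eq_empty_of_forall_notMem fun q _ => (q.2 ⟨0, hm⟩).elim0
        rw [hempty, card_empty]
        exact Nat.zero_le _
    · have h1 := card_dominant_le_succ d v ε (hC m K d v ε)
      have hX : 1 ≤ K + Nat.log 2 m ^ 2 := by omega
      calc (univ.filter fun q : Equiv.Perm (Fin m) × (Fin m → Fin K) => ∃ t : ℤ, IsDominant d v ε t q).card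
          ≤ 2 ^ (C * (K + Nat.log 2 m ^ 2)) + 1 := h1
        _ ≤ 2 ^ (C * (K + Nat.log 2 m ^ 2)) + 2 ^ (C * (K + Nat.log 2 m ^ 2)) :=
            Nat.add_le_add_left Nat.one_le_two_pow _
        _ = 2 ^ (C * (K + Nat.log 2 m ^ 2) + 1) := by rw [pow_succ]; ring
        _ ≤ 2 ^ ((C + 1) * (K + Nat.log 2 m ^ 2)) := Nat.pow_le_pow_right two_pos (by nlinarith)
  · rintro ⟨C, hC⟩
    refine tropicalB_iff_unsigned.mpr ⟨C, fun m K d v ε n θ p hθ hdom hne => ?_⟩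
    have h1 := succ_le_card_dominant d v ε θ p hθ hdom hne
    have h2 := hC m K d v ε
    omega

end VertexCount

end Summit.ValiantsHypothesis.ValiantsHypothesis.Theorems.KPlusLogSqLaw
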